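import Mathlib.Algebra.BigOperators.Group.Finset.Basic
import Mathlib.Tactic.Linarith
import Mathlib.Tactic.NormNum
import Mathlib.Tactic.Ring
import HarnessLib

/-!
# The (0,1) cell of the ι-window, XXXIX: the product ground `B₁ × B₂`, XXVI — THE CORNER XI: THE CROSS IS EXCLUDED
# (report [XXXIX] `H2-ZERO-ONE-39.md`): arithmetic shadows of LEMMA P-RESIDUAL, LEMMA EMB / CONTACT, THEOREM PLAIN, THEOREM H′-ONE,
# COROLLARY H′-ONE-ROWS and THEOREM P-CAP

Family `hodge`, b2b cell `hweil` (helper of item stmt-HodgeConjecture-2524). Report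
`run/shared/lean/b2b/hodge-weil/b2b-hweil-pv1-g51/H2-ZERO-ONE-39.md` ([XXXIX]). Context (the report's words, nothing of them formalised here): in the five
`h′ = 1` cells of the type-1 residual a (0,1) object was reduced by [XXXVIII] 10.3 to THE CROSS — the theta structure `Y_h` (multiplicity `m_h`, support
`C = Θ_κ × {z_i}`) and one ι-fixed one-x̃-block S-line `Y_z` (multiplicity `m_z = B − m_h`, `B = W′·S/2 ∈ {70, 74, 78, 82, 86}`) through the same two
2-torsion points `q±`. [XXXIX] restricts the section `s′` cutting out `W′` to the abelian surface `P = B₁ × {z_i}`: after dividing by the divisorial part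
`E ≡ nΘ` of `W′ ∩ P` the residual zero-scheme has length `W′·f′ + 2ρn + 2n²` (`= 52` for `n = 2`, `ρ = 4`), and it contains, at every point of `C`, the
embedded part of `Y_h ∩ P` (total length `ℓ_{m_h−1} = 10 + c₀ ≥ 8(m_h − 1)`) minus at most `L′_q − 1 ≤ m_h − 1` at each of `q±` (LEMMA P-RESIDUAL, LEMMA
EMB / CONTACT). Hence `m_h ≤ 9`, while the line's budget needs `m_z ≤ 42 + 2m_h`: `B ≤ 69 < 70` (THEOREM H′-ONE, non-plain line); a plain line has
`ε₂ ≥ 8` by the parity of `[a]₂` and dies at `B ≤ 52` (THEOREM PLAIN). The theorems below are the integer identities and inequalities behind these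
statements. None of them claims geometry. HONEST FRAMING: census work inside the ladder's H2 test ((0,1) cell) on the SPECIAL fourfold `X₀`; nothing
here is a rung; no case of the Hodge conjecture is proved; no statement of [Markman 2025] / [Perry 2026] / [EdGFS 2025] is used.
-/

-- mandated namespace `Summit.HodgeConjecture.HodgeConjecture.…` (Problem = Summit) trips `linter.dupNamespace`; the lakefile disables it
-- tree-wide (weak option), restated here so stand-alone elaboration is warning-free too.
set_option linter.dupNamespace false

namespace Summit.HodgeConjecture.HodgeConjecture.WeilTypeLadder

section ProductGroundTwentySix

/-- **[XXXIX] 4.1 (LEMMA P-RESIDUAL, the Chern count).** On `P = B₁ × {z_i}`: `c₁(𝓔′|_P) = −ρΘ`, `c₂(𝓔′|_P) = W′·f′ =: Φ`; the divisorial part of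
`W′ ∩ P` is `E = νΓ + ν_hC` with `Θ·E = 2ν + 2ν_h` and `E² = 2ν² + 2ν_h² + 4νν_h = 2(ν + ν_h)²` (`Θ² = Θ_κ² = Θ·Θ_κ = 2`); so with `n = ν + ν_h`:
`c₂(𝓔′|_P(−E)) = Φ + ρ(Θ·E) + E² = Φ + 2ρn + 2n²`. Values at `ρ = 4`: `Φ = 28`: `38, 52, 70` (`n = 1, 2, 3`); `Φ = 36`: `46, 60, 78`; `Φ = 44`: `54, 68, 86`;
at `ρ = 6`, `Φ = 38`, `n = 1`: `52`. [`ring`, `norm_num`] -/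
theorem pg26_p_residual_count :
    (∀ ν νh : ℤ, 2 * ν ^ 2 + 2 * νh ^ 2 + 4 * ν * νh = 2 * (ν + νh) ^ 2) ∧
    (∀ Φ ρ ν νh : ℤ, Φ + ρ * (2 * ν + 2 * νh) + (2 * ν ^ 2 + 2 * νh ^ 2 + 4 * ν * νh) = Φ + 2 * ρ * (ν + νh) + 2 * (ν + νh) ^ 2) ∧
    ((28 : ℤ) + 2 * 4 * 1 + 2 * 1 ^ 2 = 38 ∧ (28 : ℤ) + 2 * 4 * 2 + 2 * 2 ^ 2 = 52 ∧ (28 : ℤ) + 2 * 4 * 3 + 2 * 3 ^ 2 = 70) ∧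
    ((36 : ℤ) + 2 * 4 * 1 + 2 * 1 ^ 2 = 46 ∧ (36 : ℤ) + 2 * 4 * 2 + 2 * 2 ^ 2 = 60 ∧ (36 : ℤ) + 2 * 4 * 3 + 2 * 3 ^ 2 = 78) ∧
    ((44 : ℤ) + 2 * 4 * 1 + 2 * 1 ^ 2 = 54 ∧ (44 : ℤ) + 2 * 4 * 2 + 2 * 2 ^ 2 = 68 ∧ (44 : ℤ) + 2 * 4 * 3 + 2 * 3 ^ 2 = 86) ∧
    ((38 : ℤ) + 2 * 6 * 1 + 2 * 1 ^ 2 = 52) := by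
  refine ⟨fun ν νh => by ring, fun Φ ρ ν νh => by ring, by norm_num, by norm_num, by norm_num, by norm_num⟩

/-- **[XXXIX] 3.1 (LEMMA EMB, the two telescopings).** (a) For layer degrees `ℓ 0 = 0, ℓ 1, …` of a planar multiple structure on a genus-2 curve,
`χ(𝒪_{Y_j}) = Σ_{i<j}(ℓ i − 1)`, and the embedded part of `Y ∩ P` has length `χ(𝒪_Y) − χ(𝒪_C) − χ(𝒪_{Y_{m−1}}) = ℓ(m − 1)` (`χ(𝒪_C) = −1`; the
identity holds for any `ℓ`). (b) In graph form the local lengths are `Σ_{j<m−1}(k(j+1) − k j − k₁ + z₁) = k(m − 1) − (m − 1)(k₁ − z₁)` when `k 0 = 0`. [`Finset.sum_range_succ`, induction] -/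
theorem pg26_emb_telescope (ℓ k : ℕ → ℤ) (hk : k 0 = 0) (k₁ z₁ : ℤ) :
    (∀ m : ℕ, 1 ≤ m →
      (Finset.sum (Finset.range m) (fun i => ℓ i - 1)) - (-1) - (Finset.sum (Finset.range (m - 1)) (fun i => ℓ i - 1)) = ℓ (m - 1)) ∧
    (∀ m : ℕ, 1 ≤ m →
      Finset.sum (Finset.range (m - 1)) (fun j => k (j + 1) - k j - k₁ + z₁) = k (m - 1) - ((m : ℤ) - 1) * (k₁ - z₁)) := by
  constructor
  · intro m hm
    obtain ⟨n, rfl⟩ : ∃ n, m = n + 1 := ⟨m - 1, by omega⟩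
    simp only [Nat.add_sub_cancel, Finset.sum_range_succ]
    ring
  · intro m hm
    obtain ⟨n, rfl⟩ : ∃ n, m = n + 1 := ⟨m - 1, by omega⟩
    simp only [Nat.add_sub_cancel]
    induction n with
    | zero => simp [hk]
    | succ p ih =>
      rw [Finset.sum_range_succ, ih (by omega)]
      push_cast
      ring

/-- **[XXXIX] 3.2 / 4.2 (CONTACT and the local residual, bookkeeping).** At a crossing point `q`: `L′_q = 1 + λ′_q` with `λ′_q ≤ e_q` (the contact of `Γ`
with the embedded part is at most its length), and the residual ideal `(I′ : x̃^ν)` has colength `e_q − colength(I′ + (x̃^ν)) ≥ e_q − νλ′_q`. Summing over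
`C` with the two crossing points `q±` (`ν = 1`): if the residual length is `R`, then `R ≥ (ℓ − e₊ − e₋) + (e₊ − λ₊) + (e₋ − λ₋)` gives `ℓ ≤ R − 2 + L′`
with `L′ = (1 + λ₊) + (1 + λ₋)`; for `ν = 2`: `ℓ ≤ R − 4 + 2L′`. [`omega`] -/
theorem pg26_contact_residual :
    (∀ R ℓ e₁ e₂ lam₁ lam₂ L : ℤ, (ℓ - e₁ - e₂) + (e₁ - lam₁) + (e₂ - lam₂) ≤ R → L = (1 + lam₁) + (1 + lam₂) → ℓ ≤ R - 2 + L) ∧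
    (∀ R ℓ e₁ e₂ lam₁ lam₂ L : ℤ, (ℓ - e₁ - e₂) + (e₁ - 2 * lam₁) + (e₂ - 2 * lam₂) ≤ R → L = (1 + lam₁) + (1 + lam₂) → ℓ ≤ R - 4 + 2 * L) ∧
    (∀ e lam c ν : ℤ, c ≤ ν * lam → e - ν * lam ≤ e - c) := by
  refine ⟨fun R ℓ e₁ e₂ l₁ l₂ L h hL => by omega, fun R ℓ e₁ e₂ l₁ l₂ L h hL => by omega, fun e lam c ν h => by omega⟩

/-- **[XXXIX] 5.1 (THEOREM PLAIN, the parity count).** `[a]₂` is a rational section of `K₁^{−2}` (degree `−4`): `#poles = ε₂ = #zeros + 4`; it is ODD at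
each of the six Weierstrass points, so it has a zero at the `6 − f₂` of them outside `supp D₂`: `ε₂ − 4 ≥ 6 − f₂`. With LINE-SOCLE (`x_C = 1`:
`ε₂ ≥ 6 + f₂`; `x_C = 0`: `ε₂ ≥ 4 + f₂`): `ε₂ ≥ 8` resp. `ε₂ ≥ 7`. And the top layer: `8·((m − 1)/2) ≥ 4m − 8`, `6·((m − 1)/2) ≥ 3m − 6` (integer
division), so `c₀ = ε_{m−1} − 2m − 8 ≥ 2m − 16` (plain) resp. `≥ m − 14` (`ε₂ ≥ 6`). [`omega`] -/
theorem pg26_plain_parity :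
    (∀ ε₂ f₂ zeros : ℤ, ε₂ = zeros + 4 → 6 - f₂ ≤ zeros → 10 - f₂ ≤ ε₂) ∧
    (∀ ε₂ f₂ : ℤ, 6 + f₂ ≤ ε₂ → 10 - f₂ ≤ ε₂ → 8 ≤ ε₂) ∧
    (∀ ε₂ f₂ : ℤ, 4 + f₂ ≤ ε₂ → 10 - f₂ ≤ ε₂ → 7 ≤ ε₂) ∧
    (∀ m : ℤ, 1 ≤ m → 4 * m - 8 ≤ 8 * ((m - 1) / 2) ∧ 3 * m - 6 ≤ 6 * ((m - 1) / 2)) ∧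
    (∀ m εtop c₀ : ℤ, 1 ≤ m → εtop = 2 * m + 8 + c₀ → 8 * ((m - 1) / 2) ≤ εtop → 2 * m - 16 ≤ c₀) ∧
    (∀ m εtop c₀ : ℤ, 1 ≤ m → εtop = 2 * m + 8 + c₀ → 6 * ((m - 1) / 2) ≤ εtop → m - 14 ≤ c₀) := by
  refine ⟨fun ε₂ f₂ z h1 h2 => by omega, fun ε₂ f₂ h1 h2 => by omega, fun ε₂ f₂ h1 h2 => by omega, fun m hm => by omega,
    fun m εt c₀ hm h1 h2 => by omega, fun m εt c₀ hm h1 h2 => by omega⟩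

/-- **[XXXIX] 5.2 (THEOREM PLAIN, the budget in THE CROSS).** Plain line: `c₀ ≥ 2m_z − 16` and `c₀ ≤ Λ_z ≤ 28 + L′ ≤ 28 + 2m_h` give `m_z ≤ 22 + m_h`;
with THETA-CAP `10m_h ≤ 46 + 2B` (`B = m_z + m_h`): `B ≤ 52`; with P-RESIDUAL at `ν = 2` (`8(m_h − 1) ≤ ℓ ≤ 70 − 4 + 2L′ ≤ 66 + 4m_h`): `m_h ≤ 18` and
`B ≤ 58`. Both `< 70`. [`omega`] -/
theorem pg26_plain_budget :
    (∀ B mh mz c₀ L : ℤ, B = mz + mh → 2 * mz - 16 ≤ c₀ → c₀ ≤ 28 + L → L ≤ 2 * mh → 10 * mh ≤ 46 + 2 * B → B ≤ 52) ∧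
    (∀ B mh mz c₀ L ℓ : ℤ, B = mz + mh → 2 * mz - 16 ≤ c₀ → c₀ ≤ 28 + L → L ≤ 2 * mh → 8 * (mh - 1) ≤ ℓ → ℓ ≤ 66 + 2 * L →
        mh ≤ 18 ∧ B ≤ 58) := by
  refine ⟨fun B mh mz c₀ L hB h1 h2 h3 h4 => by omega, fun B mh mz c₀ L ℓ hB h1 h2 h3 h4 h5 => by omega⟩

/-- **[XXXIX] 6.1 (THEOREM H′-ONE ★, the assembly for a NON-PLAIN line).** (Θ) `ℓ ≥ 8(m_h − 1)`; (P) `ℓ + 2 − L′ ≤ 52`, `L′ ≤ 2m_h`; (Line)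
`m_z − 14 ≤ c₀ ≤ 28 + L′`. Then `m_h ≤ 9` and `B = m_z + m_h ≤ 69`; in particular `B ∉ {70, 74, 78, 82, 86}` — the five `h′ = 1` cells `(7, d₃, 21, d₃ + 1)`,
`d₃ = 9…13` (`B = 34 + 4d₃`), admit no CROSS. [`omega`] -/
theorem pg26_h_prime_one_void :
    (∀ B mh mz ℓ L c₀ : ℤ, B = mz + mh → 8 * (mh - 1) ≤ ℓ → ℓ + 2 - L ≤ 52 → L ≤ 2 * mh → mz - 14 ≤ c₀ → c₀ ≤ 28 + L →
        mh ≤ 9 ∧ mz ≤ 42 + 2 * mh ∧ B ≤ 69) ∧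
    (∀ d₃ : ℤ, 9 ≤ d₃ → 70 ≤ 34 + 4 * d₃) ∧
    ((34 : ℤ) + 4 * 9 = 70 ∧ (34 : ℤ) + 4 * 10 = 74 ∧ (34 : ℤ) + 4 * 11 = 78 ∧ (34 : ℤ) + 4 * 12 = 82 ∧ (34 : ℤ) + 4 * 13 = 86) := by
  refine ⟨fun B mh mz ℓ L c₀ hB h1 h2 h3 h4 h5 => by omega, fun d₃ h => by omega, by norm_num⟩

/-- **[XXXIX] 6.3 (COROLLARY H′-ONE-ROWS, the other rows' ten h′ = 1 cells).** With `W′·f′ = Φ` in place of `28` (residual length `Φ + 24` at `n = 2`,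
`F_S ≤ Φ`): (Θ)+(P) give `6m_h ≤ Φ + 30`, (Line) gives `m_z ≤ Φ + 14 + 2m_h`. `Φ = 36` (RB-22 type 2): `m_h ≤ 11`, `B ≤ 83 < 98`; `Φ = 44` (type 5):
`m_h ≤ 12`, `B ≤ 94 < 130`. Plain lines there: `2m_z − 16 ≤ Φ + 2m_h` and THETA-CAP `8(m_h − 1) ≤ 10 + Φ + 2m_z` give `B ≤ 60` resp. `B ≤ 70`. The cells
have `B = 54 + 4d₃ ≥ 98` (`d₃ ≥ 11`) resp. `B = 78 + 4d₃ ≥ 130` (`d₃ ≥ 13`). [`omega`] -/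
theorem pg26_h_prime_one_rows :
    (∀ B mh mz ℓ L c₀ : ℤ, B = mz + mh → 8 * (mh - 1) ≤ ℓ → ℓ + 2 - L ≤ 36 + 24 → L ≤ 2 * mh → mz - 14 ≤ c₀ → c₀ ≤ 36 + L →
        mh ≤ 11 ∧ B ≤ 83) ∧
    (∀ B mh mz ℓ L c₀ : ℤ, B = mz + mh → 8 * (mh - 1) ≤ ℓ → ℓ + 2 - L ≤ 44 + 24 → L ≤ 2 * mh → mz - 14 ≤ c₀ → c₀ ≤ 44 + L →
        mh ≤ 12 ∧ B ≤ 94) ∧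
    (∀ B mh mz c₀ : ℤ, B = mz + mh → 2 * mz - 16 ≤ c₀ → c₀ ≤ 36 + 2 * mh → 8 * (mh - 1) ≤ 10 + 36 + 2 * mz → B ≤ 60) ∧
    (∀ B mh mz c₀ : ℤ, B = mz + mh → 2 * mz - 16 ≤ c₀ → c₀ ≤ 44 + 2 * mh → 8 * (mh - 1) ≤ 10 + 44 + 2 * mz → B ≤ 70) ∧
    (∀ d₃ : ℤ, 11 ≤ d₃ → 98 ≤ 54 + 4 * d₃) ∧ (∀ d₃ : ℤ, 13 ≤ d₃ → 130 ≤ 78 + 4 * d₃) := by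
  refine ⟨fun B mh mz ℓ L c₀ hB h1 h2 h3 h4 h5 => by omega, fun B mh mz ℓ L c₀ hB h1 h2 h3 h4 h5 => by omega,
    fun B mh mz c₀ hB h1 h2 h3 => by omega, fun B mh mz c₀ hB h1 h2 h3 => by omega, fun d₃ h => by omega, fun d₃ h => by omega⟩

/-- **[XXXIX] 4.3 (THEOREM P-CAP, generalised THETA-CAP).** `8(m_h − 1) ≤ ℓ_{m_h−1} ≤ Φ + 2ρ(1 + ν) + 2(1 + ν)² + ν(L′ − 2)`, `L′ ≤ 2m_h`: at `ρ = 4`,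
`Φ = 28`: `ν = 0` (no S-line at the height `z_i`): `ℓ ≤ 38`, `m_h ≤ 5` — with NO hypothesis on bi-dominant S-curves through `q±` —; `ν = 1`: `m_h ≤ 9`;
`ν = 2`: `m_h ≤ 18`. At `ρ = 6`, `Φ = 38` ((8,3,19,15)): `ν = 0`: `ℓ ≤ 52`, `m_h ≤ 7`. At `Φ = 36 / 44` (`ρ = 4`): `ν = 0`: `m_h ≤ 6 / 7`. [`omega`] -/
theorem pg26_p_cap :
    (∀ mh ℓ : ℤ, 8 * (mh - 1) ≤ ℓ → ℓ ≤ 38 → mh ≤ 5) ∧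
    (∀ mh ℓ L : ℤ, 8 * (mh - 1) ≤ ℓ → ℓ ≤ 52 + 1 * (L - 2) → L ≤ 2 * mh → mh ≤ 9) ∧
    (∀ mh ℓ L : ℤ, 8 * (mh - 1) ≤ ℓ → ℓ ≤ 70 + 2 * (L - 2) → L ≤ 2 * mh → mh ≤ 18) ∧
    (∀ mh ℓ : ℤ, 8 * (mh - 1) ≤ ℓ → ℓ ≤ 52 → mh ≤ 7) ∧
    (∀ mh ℓ : ℤ, 8 * (mh - 1) ≤ ℓ → ℓ ≤ 46 → mh ≤ 6) ∧
    (∀ mh ℓ : ℤ, 8 * (mh - 1) ≤ ℓ → ℓ ≤ 54 → mh ≤ 7) := by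
  refine ⟨fun mh ℓ h1 h2 => by omega, fun mh ℓ L h1 h2 h3 => by omega, fun mh ℓ L h1 h2 h3 => by omega, fun mh ℓ h1 h2 => by omega,
    fun mh ℓ h1 h2 => by omega, fun mh ℓ h1 h2 => by omega⟩

/-- **[XXXIX] 6.2 / 6.4 (the residual counts).** Type 1: `60 − 5 = 55 = 17 + 35 + 3` (`40 − 5 = 35`); RB-22 type 2: `67 − 5 = 62`; type 5: `77 − 5 = 72`;
the three restrictions of record: `S` (P′), `P` (this report), `S_κ` (`2B + 8 + (2d₃ − 2)φ`: `c₂ = 2B`, `c₁ ≡ −8F + (4 − 2d₃)G`, `E = G + φF`, `F·G = 1`).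
[`norm_num`, `ring`] -/
theorem pg26_residual_counts :
    ((60 : ℤ) - 5 = 55 ∧ (55 : ℤ) = 17 + 35 + 3 ∧ (40 : ℤ) - 5 = 35 ∧ (67 : ℤ) - 5 = 62 ∧ (77 : ℤ) - 5 = 72 ∧ (35 : ℤ) + 17 + 3 + 8 = 63) ∧
    (∀ B d₃ φ : ℤ, 2 * B - ((-8) * 1 + (4 - 2 * d₃) * φ * 1) + 2 * φ * 1 = 2 * B + 8 + (2 * d₃ - 2) * φ) := by
  refine ⟨by norm_num, fun B d₃ φ => by ring⟩

end ProductGroundTwentySix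

end Summit.HodgeConjecture.HodgeConjecture.WeilTypeLadder
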